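import Summits.BirchSwinnertonDyer.BirchSwinnertonDyer.Theses.LeadingTerm
import Literature.NumberTheory.EllipticCurves.CongruentNumberCurveAdditiveReduction
import Literature.NumberTheory.EllipticCurves.BSDAnalyticRankTunnellCMProofs

/-!
# `LeadingTerm.PinchPrime` (crux stmt-BirchSwinnertonDyer-16218, route `LeadingTerm`):
# the pinch prime must depend on the curve — the quantifier-swapped (`∃ p ∀ W`) and the
# uniformly bounded (`∀ W ∃ p ≤ B`) strengthenings are FALSE
# (negative-side support, refuter crux-disprover seat; this file does NOT refute the crux)

The crux `S` says: every elliptic `E/ℚ` (globally minimal `W`) has SOME good ordinary prime `p ≥ 5`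
(with a canonical cyclotomic height datum `D` and a newform `f` of `W`) at which
`ord_{T=0} L_p(f, unitRoot W p, T) = rank_ℤ E(ℚ)` — `∀ W ∃ p`. Two natural strengthenings, both
stated INLINE below (no proposition is defined under `Summits/`), are refuted unconditionally and
without modularity (the `∃ f` clause is never reached — the witnesses fail at `IsOrdinaryAt`):

* `leadingTermPinchPrime_uniform_false` — there is NO single prime `p ≥ 5` pinching every curve:
  the congruent number curve `E_p : y² = x³ - p²x` (elliptic, globally minimal for squarefree `p`,
  tree theorems `isElliptic_congruentNumberCurve`, `isGloballyMinimal_congruentNumberCurve`) has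
  ADDITIVE reduction at the odd prime `p` (`ord_p Δ = 6`, `ord_p c₄ ≥ 2`; Silverman AEC VII.5
  Prop. 5.1(c); tree theorem `hasAdditiveReductionAt_congruentNumberCurve_of_dvd`), so `p` is not a
  good prime of `E_p` (`not_hasGoodReductionAtPrime_congruentNumberCurve_of_dvd`, through the
  tree's bridge `hasGoodReductionAtPrime_primesEquiv_iff_holds` between the prime-indexed predicate
  of the crux and the place-indexed one).
* `leadingTermPinchPrime_bounded_false` — for NO bound `B` does every curve have a pinch prime
  `p ≤ B`: `E_n` with `n = ∏_{5 ≤ q ≤ B, q prime} q` (squarefree) is additive at every prime in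
  `[5, B]`.

Moral for planners/provers: any proof of `S` must let the prime depend on `E` at least through its
bad primes (and, by the sibling junk analysis `order_ne_natCast_of_dvd`, its supersingular ones);
"one pinch prime for a whole family" is only available for families with a common good ordinary
prime.
-/

noncomputable section

-- D-0017: single-problem summit, so `Summit.BirchSwinnertonDyer.BirchSwinnertonDyer.…` repeats a
-- namespace BY DESIGN.
set_option linter.dupNamespace false

namespace Summit.BirchSwinnertonDyer.BirchSwinnertonDyer.Theorems.PinchPrime.Negative

open scoped MatrixGroups ModularForm
open CongruenceSubgroup Literature.NumberTheory.EllipticCurves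
  Literature.NumberTheory.EllipticCurves.ModularForms
open Summit.BirchSwinnertonDyer.BirchSwinnertonDyer.Theses

/-- **`E_n : y² = x³ - n²x` has bad reduction at every odd prime `p ∣ n`, `n` squarefree**
(additive: Silverman AEC VII.5 Prop. 5.1(c)), in the prime-indexed predicate
`HasGoodReductionAtPrime` of the crux (bridge `hasGoodReductionAtPrime_primesEquiv_iff_holds`,
tree theorem `hasAdditiveReductionAt_congruentNumberCurve_of_dvd`).
[cite: SilvermanAEC2009, VII.5 Prop. 5.1(c) and VII.1 Remark 1.1] -/
theorem not_hasGoodReductionAtPrime_congruentNumberCurve_of_dvd {n : ℕ} (hn : Squarefree n)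
    (p : ℕ) [hp : Fact p.Prime] (hp2 : p ≠ 2) (hpn : p ∣ n) :
    ¬ (congruentNumberCurve n).HasGoodReductionAtPrime p := by
  obtain ⟨v, hv⟩ : ∃ v : IsDedekindDomain.HeightOneSpectrum (NumberField.RingOfIntegers ℚ),
      (Rat.HeightOneSpectrum.primesEquiv v : ℕ) = p :=
    ⟨Rat.HeightOneSpectrum.primesEquiv.symm ⟨p, hp.out⟩, by rw [Equiv.apply_symm_apply]⟩
  have hgen : Rat.HeightOneSpectrum.natGenerator v = p := hv
  intro hgood
  have hgood' : (congruentNumberCurve n).HasGoodReductionAt v :=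
    (WeierstrassCurve.hasGoodReductionAtPrime_primesEquiv_iff_holds _ v p hv).1 hgood
  exact (hasAdditiveReductionAt_congruentNumberCurve_of_dvd v hn (hgen ▸ hp2)
    (hgen ▸ hpn)).not_hasGoodReductionAt hgood'

/-- In particular `E_p` has bad reduction at the odd prime `p`. [folklore] -/
theorem not_hasGoodReductionAtPrime_congruentNumberCurve_self (p : ℕ) [hp : Fact p.Prime]
    (hp2 : p ≠ 2) : ¬ (congruentNumberCurve p).HasGoodReductionAtPrime p :=
  not_hasGoodReductionAtPrime_congruentNumberCurve_of_dvd hp.out.prime.squarefree p hp2 dvd_rfl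

/-- **No uniform pinch prime.** The quantifier-swapped strengthening `∃ p ≥ 5 ∀ W` of the crux
(inline) is false: at each prime `p ≥ 5` the globally minimal elliptic curve `E_p : y² = x³ - p²x`
is not even good at `p`. [folklore] -/
theorem leadingTermPinchPrime_uniform_false :
    ¬ ∃ (p : ℕ) (_ : Fact p.Prime), 5 ≤ p ∧
        ∀ (W : WeierstrassCurve ℚ) [W.IsElliptic] [W.IsGloballyMinimal],
          IsOrdinaryAt W p ∧ ∃ (D : WeierstrassCurve.PAdicHeightData W p), D.IsCanonical ∧
            ∃ (N : ℕ) (_ : NeZero N) (f : CuspForm (Gamma0 N) 2), IsNewformOf W f ∧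
              (padicLFunction f (unitRoot W p : ℚ_[p])).order = W.mordellWeilRank := by
  rintro ⟨p, hp, h5, hall⟩
  haveI : (congruentNumberCurve p).IsElliptic := isElliptic_congruentNumberCurve hp.out.ne_zero
  haveI : (congruentNumberCurve p).IsGloballyMinimal :=
    isGloballyMinimal_congruentNumberCurve hp.out.prime.squarefree
  exact not_hasGoodReductionAtPrime_congruentNumberCurve_self p (by omega)
    (hall (congruentNumberCurve p)).1.1

/-- **No curve-independent bound on the pinch prime.** For every `B`, the strengthening
`∀ W ∃ p ∈ [5, B]` of the crux (inline) is false: with `n` the (squarefree) product of the primes in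
`[5, B]`, the globally minimal elliptic curve `E_n : y² = x³ - n²x` is additive at every candidate
prime. (For `B < 5` the statement is already empty.) [folklore] -/
theorem leadingTermPinchPrime_bounded_false (B : ℕ) :
    ¬ ∀ (W : WeierstrassCurve ℚ) [W.IsElliptic] [W.IsGloballyMinimal],
        ∃ (p : ℕ) (_ : Fact p.Prime), 5 ≤ p ∧ p ≤ B ∧
          IsOrdinaryAt W p ∧ ∃ (D : WeierstrassCurve.PAdicHeightData W p), D.IsCanonical ∧
            ∃ (N : ℕ) (_ : NeZero N) (f : CuspForm (Gamma0 N) 2), IsNewformOf W f ∧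
              (padicLFunction f (unitRoot W p : ℚ_[p])).order = W.mordellWeilRank := by
  intro h
  -- `n` = product of the primes in `[5, B]`
  set s : Finset ℕ := (Finset.range (B + 1)).filter (fun q => q.Prime ∧ 5 ≤ q) with hs
  set n : ℕ := ∏ q ∈ s, q with hn
  have hprime : ∀ q ∈ s, q.Prime := fun q hq => ((Finset.mem_filter.mp hq).2).1
  have hn0 : n ≠ 0 := Finset.prod_ne_zero_iff.mpr fun q hq => (hprime q hq).ne_zero
  have hsq : Squarefree n := by
    rw [hn]
    exact Finset.squarefree_prod_of_pairwise_isCoprime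
      (fun q hq r hr hqr => Nat.coprime_iff_isRelPrime.mp
        ((Nat.coprime_primes (hprime q hq) (hprime r hr)).mpr hqr))
      (fun q hq => (hprime q hq).prime.squarefree)
  haveI : (congruentNumberCurve n).IsElliptic := isElliptic_congruentNumberCurve hn0
  haveI : (congruentNumberCurve n).IsGloballyMinimal := isGloballyMinimal_congruentNumberCurve hsq
  obtain ⟨p, hp, h5, hpB, hat⟩ := h (congruentNumberCurve n)
  have hps : p ∈ s := Finset.mem_filter.mpr ⟨Finset.mem_range.mpr (by omega), hp.out, h5⟩
  exact not_hasGoodReductionAtPrime_congruentNumberCurve_of_dvd hsq p (by omega)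
    (Finset.dvd_prod_of_mem _ hps) hat.1.1

end Summit.BirchSwinnertonDyer.BirchSwinnertonDyer.Theorems.PinchPrime.Negative

end
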